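import Mathlib
import Summits.ResolutionOfSingularities.ResolutionOfSingularities.Theorems.WeightedInvariantHypersurfaceLocalGameEFTDimTwoFace
import Summits.ResolutionOfSingularities.ResolutionOfSingularities.Theorems.WeightedInvariantIotaOrder
import HarnessLib

/-!
# The e.f.t. local weighted game (door `HypersurfaceCentreConstruction`): the tangent cone off the vertex (K4b)

Topic: `Summits/ResolutionOfSingularities/ResolutionOfSingularities/Theorems`. Helper for the door item
`HypersurfaceCentreConstruction` (statement `stmt-ResolutionOfSingularities-19897`, route `WeightedInvariant`),
line `local-engine` of `res-L1-w43-plan-1` (L W4.3), ORDER (o13) «the `dim S = 2` rung of H2a′» held by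
res-type-098: kernel **K4b** (memo `L/res-type-098-w43/EFT-DIM2-DESIGN.md` §2 case B «tangent cone not a rational
`ν`-th power», SPEC of res-type-098 2026-08-27T06:43:55Z), companion of `…EFTDimTwoFace` (K4 core + K4a), second hand
res-type-078.

[OURS · L1 W4.3] Replaces the role of NO printed item; NOT a statement of the manuscript
[claim: Hironaka2017, status: under-review]. AI work, weaker than expert review.

## Statements (`κ` ANY field)

* `eq_sum_face_of_isHomogeneous` — a binary form `F` of degree `ν` is `Σ_{k ≤ ν} F_{(ν-k) e_i + k e_j} X_i^{ν-k} X_j^k`,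
  i.e. the `(1,1)`-face form of its dehomogenisation `P(s) = F(1, s)` on the axes `(i, j)`.
* `algebraMap_notMem_pow_of_isHomogeneous_of_notMem` — chart `X_i ∉ 𝔫`: if `F ≠ c (X_j - λ X_i)^ν` then `F ∉ 𝔪_𝔫^ν`.
* `algebraMap_notMem_pow_of_isHomogeneous` = **K4b**: a form `F` of degree `ν ≥ 1` which is not
  `c·(α X₀ + β X₁)^ν` has `F ∉ 𝔪_𝔫^ν` in `κ[X₀,X₁]_𝔫` at every prime `𝔫 ⊉ (X₀, X₁)`; in particular the INSEPARABLE cone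
  `(X₁^{p^e} - μ X₀^{p^e})^m` with `μ ∉ κ^p` has order `m < ν` at every point off the vertex (it is the `m`-th power of
  ONE irreducible `s^{p^e} - μ`, not a `ν`-th power of a linear form).
* `iotaOrd_lt_of_notMem_pow`, `iotaOrd_face_lt`, `iotaOrd_lt_of_isHomogeneous` — the same in the currency of
  res-type-073's order function `iotaOrd` (p502169): `iotaOrd (κ[X₀,X₁]_𝔫) Φ < ν` (universe-`0` fields, as `iotaOrd` is typed).

## References

* J. Włodarczyk, *Functorial resolution by torus actions*, arXiv:2203.03090, §2.3.9 (charts of the weighted blow-up).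
  [Wlodarczyk2022]
-/

noncomputable section

open IsLocalRing Polynomial

set_option linter.dupNamespace false -- mandated namespace of this single-conjunct summit

namespace Summit.ResolutionOfSingularities.ResolutionOfSingularities.Theorems

namespace LocalGameEFTFace

open Summit.ResolutionOfSingularities.ResolutionOfSingularities.Cruxes.HypersurfaceCentreConstruction.LocalEngine
  (iotaOrd natCast_le_iotaOrd_iff)

universe u

variable {κ : Type u} [Field κ]

/-! ### Binary forms as face forms -/

/-- The monomial `c X_i^a X_j^e` of `κ[X₀,X₁]`. [folklore] -/
theorem C_mul_X_pow_mul_X_pow_eq_monomial (i j : Fin 2) (a e : ℕ) (c : κ) :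
    MvPolynomial.C c * MvPolynomial.X i ^ a * MvPolynomial.X j ^ e =
      MvPolynomial.monomial (Finsupp.single i a + Finsupp.single j e) c := by
  rw [MvPolynomial.X_pow_eq_monomial, MvPolynomial.X_pow_eq_monomial, MvPolynomial.C_apply,
    MvPolynomial.monomial_mul, MvPolynomial.monomial_mul]
  simp

/-- An exponent of a binary form of degree `ν` has `m i + m j = ν` (`{i, j} = {0, 1}`). [folklore] -/
theorem add_eq_of_mem_support {i j : Fin 2} (hij : i ≠ j) {ν : ℕ} {F : MvPolynomial (Fin 2) κ}
    (hF : F.IsHomogeneous ν) {m : Fin 2 →₀ ℕ} (hm : m ∈ F.support) : m i + m j = ν := by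
  classical
  have hw := hF (MvPolynomial.mem_support_iff.mp hm)
  rw [Finsupp.weight_apply, Finsupp.sum_fintype _ _ (by simp)] at hw
  simp only [Pi.one_apply, smul_eq_mul, mul_one, Fin.sum_univ_two] at hw
  fin_cases i <;> fin_cases j <;> simp_all [add_comm]

/-- **A binary form of degree `ν` is the `(1,1)`-face form of its dehomogenisation**:
`F = Σ_{k ≤ ν} F_{(ν-k)e_i + k e_j} · X_i^{ν-k} X_j^k`. [folklore] -/
theorem eq_sum_face_of_isHomogeneous {i j : Fin 2} (hij : i ≠ j) {ν : ℕ} {F : MvPolynomial (Fin 2) κ}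
    (hF : F.IsHomogeneous ν) :
    F = ∑ k ∈ Finset.range (ν + 1),
      MvPolynomial.C (F.coeff (Finsupp.single i (ν - k) + Finsupp.single j k)) *
        MvPolynomial.X i ^ (ν - k) * MvPolynomial.X j ^ k := by
  classical
  set τ : ℕ → (Fin 2 →₀ ℕ) := fun k => Finsupp.single i (ν - k) + Finsupp.single j k with hτ
  have hτj : ∀ k, τ k j = k := fun k => by simp [hτ, hij]
  have hτi : ∀ k, τ k i = ν - k := fun k => by simp [hτ, hij.symm]
  have hinj : Set.InjOn τ (Finset.range (ν + 1) : Set ℕ) := fun k _ k' _ h => by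
    have := congrArg (fun d => d j) h
    simpa [hτj] using this
  -- every exponent of `F` is a `τ k`
  have hsub : F.support ⊆ (Finset.range (ν + 1)).image τ := by
    intro m hm
    have hsum := add_eq_of_mem_support hij hF hm
    refine Finset.mem_image.mpr ⟨m j, Finset.mem_range.mpr (by omega), ?_⟩
    ext k'
    by_cases hk' : k' = i
    · rw [hk', hτi]; omega
    · rw [fin_two_eq_of_ne hij hk', hτj]
  simp_rw [C_mul_X_pow_mul_X_pow_eq_monomial]
  rw [← Finset.sum_image (f := fun m => MvPolynomial.monomial m (F.coeff m)) hinj]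
  rw [← Finset.sum_subset hsub (fun m _ hm => by
    rw [MvPolynomial.notMem_support_iff.mp hm, map_zero])]
  exact F.as_sum

/-! ### K4b: the tangent cone -/

/-- **K4b on the chart `X_i ∉ 𝔫`**: a binary form `F` of degree `ν ≥ 1` which is not `c (X_j - λ X_i)^ν` has
`F ∉ 𝔪_𝔫^ν` in `κ[X₀,X₁]_𝔫` at every prime `𝔫 ∌ X_i`. [cite: Wlodarczyk2022, §2.3.9] -/
theorem algebraMap_notMem_pow_of_isHomogeneous_of_notMem {i j : Fin 2} (hij : i ≠ j) {ν : ℕ} (hν : 1 ≤ ν)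
    {F : MvPolynomial (Fin 2) κ} (hF : F.IsHomogeneous ν)
    (hFν : ¬ ∃ c l : κ, F = MvPolynomial.C c * (MvPolynomial.X j - MvPolynomial.C l * MvPolynomial.X i) ^ ν)
    (𝔫 : Ideal (MvPolynomial (Fin 2) κ)) [𝔫.IsPrime] (hi : MvPolynomial.X i ∉ 𝔫) :
    algebraMap (MvPolynomial (Fin 2) κ) (Localization.AtPrime 𝔫) F ∉
      maximalIdeal (Localization.AtPrime 𝔫) ^ ν := by
  classical
  -- the dehomogenisation `P(s) = F` read on the chart
  set P : κ[X] := ∑ k ∈ Finset.range (ν + 1),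
    Polynomial.monomial k (F.coeff (Finsupp.single i (ν - k) + Finsupp.single j k)) with hPdef
  have hPcoeff : ∀ k ∈ Finset.range (ν + 1),
      P.coeff k = F.coeff (Finsupp.single i (ν - k) + Finsupp.single j k) := fun k hk => by
    rw [hPdef, Polynomial.finsetSum_coeff]
    simp_rw [Polynomial.coeff_monomial]
    rw [Finset.sum_eq_single k (fun k' _ hk' => if_neg hk') (fun h => absurd hk h), if_pos rfl]
  have hdeg : P.natDegree ≤ ν := by
    refine Polynomial.natDegree_sum_le_of_forall_le _ _ fun k hk => ?_
    exact (Polynomial.natDegree_monomial_le _).trans (Nat.lt_succ_iff.mp (Finset.mem_range.mp hk))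
  have hΦ : F = ∑ k ∈ Finset.range (ν + 1),
      MvPolynomial.C (P.coeff k) * MvPolynomial.X i ^ (1 * (ν - k)) * MvPolynomial.X j ^ k := by
    conv_lhs => rw [eq_sum_face_of_isHomogeneous hij hF]
    exact Finset.sum_congr rfl fun k hk => by rw [hPcoeff k hk, one_mul]
  have hP : ¬ ∃ c l : κ, P = C c * (X - C l) ^ ν := by
    rintro ⟨c, l, hcl⟩
    apply hFν
    refine ⟨c, l, ?_⟩
    have hcoeffk : ∀ k ∈ Finset.range (ν + 1), P.coeff k = c * (ν.choose k : κ) * (-l) ^ (ν - k) := by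
      intro k _
      rw [hcl, Polynomial.coeff_C_mul, sub_eq_add_neg, ← Polynomial.C_neg, Polynomial.coeff_X_add_C_pow]
      ring
    rw [hΦ, sub_eq_add_neg, add_pow, Finset.mul_sum]
    refine Finset.sum_congr rfl fun k hk => ?_
    rw [hcoeffk k hk, one_mul, map_mul, map_mul, map_pow, map_neg, map_natCast, neg_pow,
      neg_pow ((MvPolynomial.C l : MvPolynomial (Fin 2) κ) * MvPolynomial.X i), mul_pow]
    ring
  exact algebraMap_face_notMem_pow_of_notMem hij hν hdeg hP hΦ 𝔫 hi

/-- **K4b (res-type-098 EFT-DIM2-DESIGN §2, case B — the tangent cone is not a rational `ν`-th power)**: let `κ` be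
any field and `F ∈ κ[X₀,X₁]` a form of degree `ν ≥ 1` which is NOT `c (α X₀ + β X₁)^ν` (`c, α, β ∈ κ`).  Then at every
prime `𝔫` off the vertex (`(X₀, X₁) ⊄ 𝔫`), `F ∉ 𝔪_𝔫^ν` in `κ[X₀,X₁]_𝔫`: the ordinary point move wins at every point of
the exceptional curve.  The inseparable cone `c (X₁^{p^e} - μ X₀^{p^e})^m`, `μ ∉ κ^p`, is NOT an exception.
[cite: Wlodarczyk2022, §2.3.9] -/
theorem algebraMap_notMem_pow_of_isHomogeneous {ν : ℕ} (hν : 1 ≤ ν) {F : MvPolynomial (Fin 2) κ}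
    (hF : F.IsHomogeneous ν)
    (hFν : ¬ ∃ c α β : κ, F = MvPolynomial.C c *
      (MvPolynomial.C α * MvPolynomial.X 0 + MvPolynomial.C β * MvPolynomial.X 1) ^ ν)
    (𝔫 : Ideal (MvPolynomial (Fin 2) κ)) [𝔫.IsPrime]
    (hvert : ¬ Ideal.span {(MvPolynomial.X 0 : MvPolynomial (Fin 2) κ), MvPolynomial.X 1} ≤ 𝔫) :
    algebraMap (MvPolynomial (Fin 2) κ) (Localization.AtPrime 𝔫) F ∉
      maximalIdeal (Localization.AtPrime 𝔫) ^ ν := by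
  by_cases h0 : (MvPolynomial.X 0 : MvPolynomial (Fin 2) κ) ∈ 𝔫
  · have h1 : (MvPolynomial.X 1 : MvPolynomial (Fin 2) κ) ∉ 𝔫 := fun h1 => hvert (by
      rw [Ideal.span_le, Set.insert_subset_iff, Set.singleton_subset_iff]
      exact ⟨h0, h1⟩)
    refine algebraMap_notMem_pow_of_isHomogeneous_of_notMem (i := 1) (j := 0) (by decide) hν hF ?_ 𝔫 h1
    rintro ⟨c, l, h⟩
    exact hFν ⟨c, 1, -l, by rw [h, map_one, one_mul, map_neg, neg_mul, sub_eq_add_neg]⟩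
  · refine algebraMap_notMem_pow_of_isHomogeneous_of_notMem (i := 0) (j := 1) (by decide) hν hF ?_ 𝔫 h0
    rintro ⟨c, l, h⟩
    exact hFν ⟨c, -l, 1, by rw [h, map_one, one_mul, map_neg, neg_mul, sub_eq_add_neg, add_comm]⟩

/-! ### The same in the currency of `iotaOrd` (universe `0`) -/

/-- `g ∉ 𝔪^ν ⇒ iotaOrd R g < ν` for a local ring `R`. [folklore] -/
theorem iotaOrd_lt_of_notMem_pow {R : Type} [CommRing R] [IsLocalRing R] {g : R} {ν : ℕ}
    (h : g ∉ maximalIdeal R ^ ν) : iotaOrd R g < ν := by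
  rw [← not_le, natCast_le_iotaOrd_iff]
  exact h

/-- **K4a in `iotaOrd`**: under the hypotheses of `algebraMap_face_notMem_pow`, `iotaOrd (κ[X₀,X₁]_𝔫) Φ < ν` at every
prime off the vertex. [cite: Wlodarczyk2022, §2.3.9] -/
theorem iotaOrd_face_lt {κ : Type} [Field κ] {b ν : ℕ} (hb : 1 ≤ b) (hν : 1 ≤ ν) {P : κ[X]}
    (hdeg : P.natDegree ≤ ν) (hPν : P.coeff ν ≠ 0) (hP : ¬ ∃ c l : κ, P = C c * (X - C l) ^ ν)
    {Φ : MvPolynomial (Fin 2) κ}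
    (hΦ : Φ = ∑ k ∈ Finset.range (ν + 1),
      MvPolynomial.C (P.coeff k) * MvPolynomial.X 0 ^ (b * (ν - k)) * MvPolynomial.X 1 ^ k)
    (𝔫 : Ideal (MvPolynomial (Fin 2) κ)) [𝔫.IsPrime]
    (hvert : ¬ Ideal.span {(MvPolynomial.X 0 : MvPolynomial (Fin 2) κ), MvPolynomial.X 1} ≤ 𝔫) :
    iotaOrd (Localization.AtPrime 𝔫) (algebraMap (MvPolynomial (Fin 2) κ) (Localization.AtPrime 𝔫) Φ) < ν :=
  iotaOrd_lt_of_notMem_pow (algebraMap_face_notMem_pow hb hν hdeg hPν hP hΦ 𝔫 hvert)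

/-- **K4b in `iotaOrd`**: a binary form of degree `ν ≥ 1` which is not `c (α X₀ + β X₁)^ν` has `iotaOrd < ν` at every
prime off the vertex. [cite: Wlodarczyk2022, §2.3.9] -/
theorem iotaOrd_lt_of_isHomogeneous {κ : Type} [Field κ] {ν : ℕ} (hν : 1 ≤ ν) {F : MvPolynomial (Fin 2) κ}
    (hF : F.IsHomogeneous ν)
    (hFν : ¬ ∃ c α β : κ, F = MvPolynomial.C c *
      (MvPolynomial.C α * MvPolynomial.X 0 + MvPolynomial.C β * MvPolynomial.X 1) ^ ν)
    (𝔫 : Ideal (MvPolynomial (Fin 2) κ)) [𝔫.IsPrime]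
    (hvert : ¬ Ideal.span {(MvPolynomial.X 0 : MvPolynomial (Fin 2) κ), MvPolynomial.X 1} ≤ 𝔫) :
    iotaOrd (Localization.AtPrime 𝔫) (algebraMap (MvPolynomial (Fin 2) κ) (Localization.AtPrime 𝔫) F) < ν :=
  iotaOrd_lt_of_notMem_pow (algebraMap_notMem_pow_of_isHomogeneous hν hF hFν 𝔫 hvert)

end LocalGameEFTFace

end Summit.ResolutionOfSingularities.ResolutionOfSingularities.Theorems

end
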